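import Literature.Topology.FourManifolds.HandlebodyKernelExtensionProofs
import Literature.Topology.FourManifolds.SPC4HandlesModelReduction
import Literature.Topology.FourManifolds.CollarTheorem
import Literature.Topology.FourManifolds.RoundSolidTorus
import Literature.Topology.FourManifolds.FlowerHandlebody
import HarnessLib

/-!
# Griffiths' handlebody extension theorem: reduction to one model per genus, up to diffeotopy

Topic `Literature/Topology/FourManifolds`; third file on the named fact
`Literature.Topology.FourManifolds.GriffithsExtension` (`HandlebodyKernelExtension.lean`;
H. B. Griffiths, *Automorphisms of a 3-dimensional handlebody*, Abh. Math. Sem. Univ. Hamburg 26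
(1964), main theorem; S. Hensel, *A primer on handlebody groups* (2020), Cor. 5.11: a
self-diffeomorphism `ψ` of the boundary of a genus-`g` handlebody `H` whose action on `π₁(∂H)`
preserves `ker (π₁ ∂H → π₁ H)` extends over `H`), after `HandlebodyKernelExtensionProofs.lean`
(line A: the doubling argument from Waldhausen's theorem).  **Everything here is proved; no
definition and no named fact is introduced; the fact is NOT discharged.**  What lands is the
standard bookkeeping with which every classical (Perelman-free) proof of the fact starts:

* §1 `map_ker_eq_ker_conj` — the kernel condition is invariant under conjugation along a
  commuting square of homeomorphisms (`Θ ∘ incl = incl₀ ∘ θ`): if `ψ_*` preserves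
  `ker (π₁ ∂H → π₁ H)` then `(θ ψ θ⁻¹)_*` preserves `ker (π₁ ∂H₀ → π₁ H₀)` (functoriality of `π₁`,
  Hatcher §1.1).
* §2 `BoundaryData.diffeoExtends_of_forall_diffeoExtends_of_diffeomorph` — **transport**: if
  Griffiths' criterion holds for ONE pair `(H₀, b₀)` and `Θ : H ≅ H₀`, it holds for `(H, b)` for
  every boundary datum `b` of `H` (§1 and `BoundaryData.DiffeoExtends.conj`).
* §3 `griffithsExtension_of_models` — **one model per genus suffices**: by the tree's proved
  classification of genus-`g` handlebodies (UNIQ, `IsHandlebody.nonempty_diffeomorph_of_oneHandle`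
  with `oneHandle_nonempty_diffeomorph_holds`) and the proved genus-`0` case
  (`griffithsExtension_genus_zero`, `Γ₃ = 0`), the fact follows from Griffiths' criterion for one
  genus-`g` handlebody with one boundary datum for each `g ≥ 1`; concretely
  (`griffithsExtension_of_roundSolidTorus_of_flower`) for the round solid torus
  `RoundSolidTorus ⊂ ℝ³` (`g = 1`) and the flower handlebodies
  `FlowerModel.FlowerHandlebody ⊂ ℝ³` (`g ≥ 2`), each with its subtype boundary datum
  `BoundaryManifold.boundaryData`.
* §4 `BoundaryData.DiffeoExtends.of_isDiffeotopic` — **extendability is a diffeotopy invariant**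
  on a compact manifold with boundary (the proved collar fact
  `BoundaryData.diffeoExtends_of_isDiffeotopicToId_holds`, Hirsch Ch. 8 §2), hence
  `griffithsExtension_of_models_isDiffeotopic`: it suffices that on each model every
  kernel-preserving `ψ` be DIFFEOTOPIC to an extendable diffeomorphism — the form in which the
  meridian-disc proof (Hensel (2020), Lemma 5.10: Dehn's lemma, disc surgery, Alexander trick)
  and the mapping-class-group proof (Dehn–Nielsen–Baer + Luft's twist group) both conclude.

## References

* H. B. Griffiths, *Automorphisms of a 3-dimensional handlebody*, Abh. Math. Sem. Univ. Hamburg 26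
  (1964) 191–210, main theorem. [GriffithsHB1964Handlebody]
* S. Hensel, *A primer on handlebody groups*, Handbook of Group Actions V, ALM 48 (2020) 143–177,
  Cor. 5.11, Lemma 5.10. [Hensel2020HandlebodyPrimer]
* A. Hatcher, *Algebraic Topology* (2002), §1.1 (p. 34), Prop. 1.18. [HatcherAT2002]
* M. W. Hirsch, *Differential Topology* (1976), Ch. 8 §2 (proof of Thm. 2.3). [HirschDT1976]
-/

noncomputable section

namespace Literature.Topology.FourManifolds

open Set Function
open scoped _root_.Manifold _root_.ContDiff _root_.Topology

universe u

/-! ### §1 The kernel condition under conjugation -/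

section KernelConj

variable {X X' Z Z' : Type*} [TopologicalSpace X] [TopologicalSpace X'] [TopologicalSpace Z]
  [TopologicalSpace Z']

/-- Equal maps kill the same classes (stated through `f = g`, so that the base points need not be
compared). [folklore] -/
private theorem map_eq_one_of_eq {f g : C(X, Z)} (h : f = g) {x : X} {γ : FundamentalGroup X x}
    (h1 : FundamentalGroup.map f x γ = 1) : FundamentalGroup.map g x γ = 1 := by
  subst h
  exact h1

/-- Post-composing with a homeomorphism does not change which classes die. [folklore] -/
private theorem map_comp_homeomorph_eq_one_iff (i : C(X, Z)) (Φ : Z ≃ₜ Z') (x : X)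
    (γ : FundamentalGroup X x) :
    FundamentalGroup.map ((Φ : C(Z, Z')).comp i) x γ = 1 ↔ FundamentalGroup.map i x γ = 1 := by
  rw [fundamentalGroup_map_comp_apply]
  constructor
  · intro h
    exact (Homeomorph.fundamentalGroup_map_bijective Φ (i x)).1 (h.trans (map_one _).symm)
  · intro h
    rw [h]
    exact map_one _

/-- **The kernel condition is invariant under conjugation along a commuting square.**  Let
`i : X → Z`, `i₀ : X' → Z'` be continuous, `θ : X ≃ₜ X'`, `Θ : Z ≃ₜ Z'` homeomorphisms with
`Θ ∘ i = i₀ ∘ θ`, and let the homeomorphism `ψ` of `X` satisfy Griffiths' kernel condition at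
`x₀` (`ψ_*` carries `ker (i_* : π₁(X, x₀) → π₁ Z)` onto `ker (i_* : π₁(X, ψ x₀) → π₁ Z)`).  Then
any homeomorphism `χ` of `X'` with `χ ∘ θ = θ ∘ ψ` (i.e. `χ = θ ψ θ⁻¹`) satisfies the kernel
condition at `θ x₀`.  Functoriality of `π₁` and bijectivity of the maps induced by homeomorphisms
(Hatcher, *Algebraic Topology* (2002), §1.1, p. 34 and Prop. 1.18).
[cite: HatcherAT2002, §1.1 (p. 34) and Prop. 1.18] -/
theorem map_ker_eq_ker_conj (i : C(X, Z)) (i₀ : C(X', Z')) (θ : X ≃ₜ X') (Θ : Z ≃ₜ Z')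
    (hsq : ∀ x, Θ (i x) = i₀ (θ x)) (ψ : X ≃ₜ X) (x₀ : X)
    (hker : ((FundamentalGroup.map i x₀).ker).map (FundamentalGroup.map (ψ : C(X, X)) x₀) =
      (FundamentalGroup.map i ((ψ : C(X, X)) x₀)).ker)
    (χ : X' ≃ₜ X') (hχ : ∀ x, χ (θ x) = θ (ψ x)) :
    ((FundamentalGroup.map i₀ ((θ : C(X, X')) x₀)).ker).map
        (FundamentalGroup.map (χ : C(X', X')) ((θ : C(X, X')) x₀)) =
      (FundamentalGroup.map i₀ ((χ : C(X', X')) ((θ : C(X, X')) x₀))).ker := by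
  -- the two commuting identities as equalities of continuous maps out of `X`
  have hsq' : (Θ : C(Z, Z')).comp i = i₀.comp (θ : C(X, X')) := ContinuousMap.ext fun x => hsq x
  have hconj : i₀.comp ((χ : C(X', X')).comp (θ : C(X, X'))) =
      (Θ : C(Z, Z')).comp (i.comp (ψ : C(X, X))) :=
    ContinuousMap.ext fun x => by
      simp only [ContinuousMap.comp_apply, ContinuousMap.coe_coe, hχ x, ← hsq (ψ x)]
  -- `γ ∈ ker i_*  ↔  θ_* γ ∈ ker i₀_*`
  have key₁ : ∀ γ : FundamentalGroup X x₀, FundamentalGroup.map i x₀ γ = 1 ↔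
      FundamentalGroup.map i₀ ((θ : C(X, X')) x₀)
        (FundamentalGroup.map (θ : C(X, X')) x₀ γ) = 1 := by
    intro γ
    rw [← fundamentalGroup_map_comp_apply, ← map_comp_homeomorph_eq_one_iff i Θ x₀ γ]
    exact ⟨map_eq_one_of_eq hsq', map_eq_one_of_eq hsq'.symm⟩
  -- `ψ_* γ ∈ ker i_*  ↔  (χ θ)_* γ ∈ ker i₀_*`
  have key₂ : ∀ γ : FundamentalGroup X x₀,
      FundamentalGroup.map i ((ψ : C(X, X)) x₀) (FundamentalGroup.map (ψ : C(X, X)) x₀ γ) = 1 ↔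
      FundamentalGroup.map i₀ ((χ : C(X', X')) ((θ : C(X, X')) x₀))
        (FundamentalGroup.map (χ : C(X', X')) ((θ : C(X, X')) x₀)
          (FundamentalGroup.map (θ : C(X, X')) x₀ γ)) = 1 := by
    intro γ
    have e1 : FundamentalGroup.map i ((ψ : C(X, X)) x₀) (FundamentalGroup.map (ψ : C(X, X)) x₀ γ) =
        FundamentalGroup.map (i.comp (ψ : C(X, X))) x₀ γ :=
      (fundamentalGroup_map_comp_apply (ψ : C(X, X)) i x₀ γ).symm
    have e3 : FundamentalGroup.map ((χ : C(X', X')).comp (θ : C(X, X'))) x₀ γ =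
        FundamentalGroup.map (χ : C(X', X')) ((θ : C(X, X')) x₀)
          (FundamentalGroup.map (θ : C(X, X')) x₀ γ) :=
      fundamentalGroup_map_comp_apply (θ : C(X, X')) (χ : C(X', X')) x₀ γ
    have e2 : FundamentalGroup.map i₀ ((χ : C(X', X')) ((θ : C(X, X')) x₀))
        (FundamentalGroup.map (χ : C(X', X')) ((θ : C(X, X')) x₀)
          (FundamentalGroup.map (θ : C(X, X')) x₀ γ)) =
        FundamentalGroup.map (i₀.comp ((χ : C(X', X')).comp (θ : C(X, X')))) x₀ γ :=
      ((fundamentalGroup_map_comp_apply ((χ : C(X', X')).comp (θ : C(X, X'))) i₀ x₀ γ).trans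
        (congrArg (FundamentalGroup.map i₀ ((χ : C(X', X')) ((θ : C(X, X')) x₀))) e3)).symm
    constructor
    · intro hA
      have h1 : FundamentalGroup.map (i.comp (ψ : C(X, X))) x₀ γ = 1 := e1.symm.trans hA
      have h2 := (map_comp_homeomorph_eq_one_iff (i.comp (ψ : C(X, X))) Θ x₀ γ).2 h1
      exact e2.trans (map_eq_one_of_eq hconj.symm h2)
    · intro hB
      have h3 : FundamentalGroup.map (i₀.comp ((χ : C(X', X')).comp (θ : C(X, X')))) x₀ γ = 1 :=
        e2.symm.trans hB
      have h2 := map_eq_one_of_eq hconj h3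
      exact e1.trans ((map_comp_homeomorph_eq_one_iff (i.comp (ψ : C(X, X))) Θ x₀ γ).1 h2)
  -- the kernel condition for `ψ`, elementwise: `γ ∈ ker i_* ↔ ψ_* γ ∈ ker i_*`
  have hψ : ∀ γ : FundamentalGroup X x₀, FundamentalGroup.map i x₀ γ = 1 ↔
      FundamentalGroup.map i ((ψ : C(X, X)) x₀) (FundamentalGroup.map (ψ : C(X, X)) x₀ γ) = 1 := by
    intro γ
    constructor
    · intro hγ
      have hmem : FundamentalGroup.map (ψ : C(X, X)) x₀ γ ∈
          ((FundamentalGroup.map i x₀).ker).map (FundamentalGroup.map (ψ : C(X, X)) x₀) :=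
        Subgroup.mem_map_of_mem _ (by rwa [MonoidHom.mem_ker])
      rw [hker, MonoidHom.mem_ker] at hmem
      exact hmem
    · intro hγ
      have hmem : FundamentalGroup.map (ψ : C(X, X)) x₀ γ ∈
          (FundamentalGroup.map i ((ψ : C(X, X)) x₀)).ker := by rwa [MonoidHom.mem_ker]
      rw [← hker, Subgroup.mem_map] at hmem
      obtain ⟨γ', hγ', hγγ⟩ := hmem
      rw [← (Homeomorph.fundamentalGroup_map_bijective ψ x₀).1 hγγ]
      rwa [MonoidHom.mem_ker] at hγ'
  ext ε
  simp only [Subgroup.mem_map, MonoidHom.mem_ker]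
  constructor
  · rintro ⟨δ, hδ, rfl⟩
    obtain ⟨γ, rfl⟩ := (Homeomorph.fundamentalGroup_map_bijective θ x₀).2 δ
    exact (key₂ γ).1 ((hψ γ).1 ((key₁ γ).2 hδ))
  · intro hε
    obtain ⟨δ, rfl⟩ := (Homeomorph.fundamentalGroup_map_bijective χ ((θ : C(X, X')) x₀)).2 ε
    obtain ⟨γ, rfl⟩ := (Homeomorph.fundamentalGroup_map_bijective θ x₀).2 δ
    exact ⟨_, (key₁ γ).1 ((hψ γ).2 ((key₂ γ).2 hε)), rfl⟩

end KernelConj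

/-! ### §2 Transport of Griffiths' criterion along a diffeomorphism -/

section Transport

variable {H H₀ : Type u} [TopologicalSpace H] [ChartedSpace (EuclideanHalfSpace 3) H]
  [TopologicalSpace H₀] [ChartedSpace (EuclideanHalfSpace 3) H₀]

/-- **Griffiths' criterion is transported by diffeomorphisms.**  If every kernel-preserving
self-diffeomorphism of the boundary datum `b₀` of `H₀` extends over `H₀`, and `Θ : H ≅ H₀` is a
diffeomorphism, then every kernel-preserving self-diffeomorphism `ψ` of ANY boundary datum `b`
of `H` extends over `H`: conjugate `ψ` by `∂Θ : b.carrier ≅ b₀.carrier`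
(`BoundaryData.restrictDiffeomorph`), observe that `∂Θ ψ ∂Θ⁻¹` is kernel-preserving
(`map_ker_eq_ker_conj`), extend it over `H₀`, and conjugate the extension back
(`BoundaryData.DiffeoExtends.conj`).  In particular the criterion for one boundary datum of `H`
gives it for all (take `Θ = id`). [cite: GriffithsHB1964Handlebody, main theorem] -/
theorem BoundaryData.diffeoExtends_of_forall_diffeoExtends_of_diffeomorph
    (b : BoundaryData (𝓡∂ 3) H (𝓡 2)) (b₀ : BoundaryData (𝓡∂ 3) H₀ (𝓡 2))
    (Θ : H ≃ₘ⟮𝓡∂ 3, 𝓡∂ 3⟯ H₀)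
    (h₀ : ∀ (χ : b₀.carrier ≃ₘ⟮𝓡 2, 𝓡 2⟯ b₀.carrier) (y₀ : b₀.carrier),
      ((FundamentalGroup.map (⟨b₀.incl, b₀.continuous_incl⟩ : C(b₀.carrier, H₀)) y₀).ker).map
          (FundamentalGroup.map (⟨χ, χ.continuous⟩ : C(b₀.carrier, b₀.carrier)) y₀)
        = (FundamentalGroup.map (⟨b₀.incl, b₀.continuous_incl⟩ : C(b₀.carrier, H₀))
            ((⟨χ, χ.continuous⟩ : C(b₀.carrier, b₀.carrier)) y₀)).ker →
      b₀.DiffeoExtends χ)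
    (ψ : b.carrier ≃ₘ⟮𝓡 2, 𝓡 2⟯ b.carrier) (x₀ : b.carrier)
    (hker : ((FundamentalGroup.map (⟨b.incl, b.continuous_incl⟩ : C(b.carrier, H)) x₀).ker).map
        (FundamentalGroup.map (⟨ψ, ψ.continuous⟩ : C(b.carrier, b.carrier)) x₀)
      = (FundamentalGroup.map (⟨b.incl, b.continuous_incl⟩ : C(b.carrier, H))
          ((⟨ψ, ψ.continuous⟩ : C(b.carrier, b.carrier)) x₀)).ker) :
    b.DiffeoExtends ψ := by
  set θ := b.restrictDiffeomorph b₀ Θ with hθ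
  set χ : b₀.carrier ≃ₘ⟮𝓡 2, 𝓡 2⟯ b₀.carrier := θ.symm.trans (ψ.trans θ) with hχ
  have hχθ : ∀ x, χ (θ x) = θ (ψ x) := fun x => by
    simp only [hχ, Diffeomorph.coe_trans, Function.comp_apply, Diffeomorph.symm_apply_apply]
  -- the conjugate is kernel-preserving at `θ x₀`
  have hkerχ := map_ker_eq_ker_conj (⟨b.incl, b.continuous_incl⟩ : C(b.carrier, H))
    (⟨b₀.incl, b₀.continuous_incl⟩ : C(b₀.carrier, H₀)) θ.toHomeomorph Θ.toHomeomorph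
    (fun x => (BoundaryData.incl_restrictDiffeomorph Θ x).symm) ψ.toHomeomorph x₀ hker
    χ.toHomeomorph hχθ
  have hext : b₀.DiffeoExtends χ := h₀ χ (θ x₀) hkerχ
  -- conjugate the extension back
  have hback := BoundaryData.DiffeoExtends.conj (b₁ := b) (b₂ := b₀) Θ hext
  have hψ : ((b.restrictDiffeomorph b₀ Θ).trans χ).trans (b.restrictDiffeomorph b₀ Θ).symm = ψ :=
    Diffeomorph.ext fun x => by
      simp only [hχ, Diffeomorph.coe_trans, Function.comp_apply, Diffeomorph.symm_apply_apply, ← hθ]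
  rwa [hψ] at hback

end Transport

/-! ### §3 One model per genus suffices -/

/-- **Griffiths' theorem from one model handlebody per positive genus.**  If for every `g ≥ 1`
SOME genus-`g` handlebody `H₀` (in `Type`) with SOME boundary datum `b₀` satisfies Griffiths'
criterion (every kernel-preserving self-diffeomorphism of `b₀.carrier` extends over `H₀`), then
`GriffithsExtension` holds: genus `0` is `griffithsExtension_genus_zero` (`Γ₃ = 0`), and for
`g ≥ 1` any genus-`g` handlebody is diffeomorphic to the model (the tree's proved classification
`IsHandlebody.nonempty_diffeomorph_of_oneHandle` / `oneHandle_nonempty_diffeomorph_holds`), so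
§2 transports the criterion. [cite: GriffithsHB1964Handlebody, main theorem] -/
theorem griffithsExtension_of_models
    (h : ∀ g : ℕ, 1 ≤ g → ∃ (H₀ : Type) (_ : TopologicalSpace H₀) (_ : T2Space H₀)
      (_ : SecondCountableTopology H₀) (_ : ChartedSpace (EuclideanHalfSpace 3) H₀)
      (_ : IsManifold (𝓡∂ 3) ∞ H₀) (_ : IsHandlebody g H₀) (b₀ : BoundaryData (𝓡∂ 3) H₀ (𝓡 2)),
      ∀ (χ : b₀.carrier ≃ₘ⟮𝓡 2, 𝓡 2⟯ b₀.carrier) (y₀ : b₀.carrier),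
        ((FundamentalGroup.map (⟨b₀.incl, b₀.continuous_incl⟩ : C(b₀.carrier, H₀)) y₀).ker).map
            (FundamentalGroup.map (⟨χ, χ.continuous⟩ : C(b₀.carrier, b₀.carrier)) y₀)
          = (FundamentalGroup.map (⟨b₀.incl, b₀.continuous_incl⟩ : C(b₀.carrier, H₀))
              ((⟨χ, χ.continuous⟩ : C(b₀.carrier, b₀.carrier)) y₀)).ker →
        b₀.DiffeoExtends χ) :
    GriffithsExtension := by
  intro g H _ _ _ _ _ hH b ψ x₀ hker
  rcases Nat.eq_zero_or_pos g with rfl | hg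
  · exact griffithsExtension_genus_zero H hH b ψ
  · obtain ⟨H₀, _, _, _, _, _, hH₀, b₀, h₀⟩ := h g hg
    obtain ⟨Θ⟩ := IsHandlebody.nonempty_diffeomorph_of_oneHandle
      oneHandle_nonempty_diffeomorph_holds g H H₀ hH hH₀
    exact b.diffeoExtends_of_forall_diffeoExtends_of_diffeomorph b₀ Θ h₀ ψ x₀ hker

open RoundSolidTorusModel (RoundSolidTorus isHandlebody_one_roundSolidTorus) in
/-- **Griffiths' theorem from the tree's explicit models**: it suffices to verify Griffiths'
criterion on the round solid torus `RoundSolidTorus = {(x² + y² - 4)² + 16 z² ≤ 1} ⊂ ℝ³`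
(genus `1`, `isHandlebody_one_roundSolidTorus`) and on the flower handlebodies
`FlowerModel.FlowerHandlebody hg = {q_g(x, y) + z² ≤ c_g} ⊂ ℝ³` (genus `g ≥ 2`,
`FlowerModel.isHandlebody_flowerHandlebody`), each with its subtype boundary datum
`BoundaryManifold.boundaryData 2 _` (carrier `∂V`, inclusion `Subtype.val`).
[cite: GriffithsHB1964Handlebody, main theorem] -/
theorem griffithsExtension_of_roundSolidTorus_of_flower
    (h₁ : ∀ (χ : (BoundaryManifold.boundaryData 2 RoundSolidTorus).carrier ≃ₘ⟮𝓡 2, 𝓡 2⟯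
        (BoundaryManifold.boundaryData 2 RoundSolidTorus).carrier)
      (y₀ : (BoundaryManifold.boundaryData 2 RoundSolidTorus).carrier),
      ((FundamentalGroup.map (⟨(BoundaryManifold.boundaryData 2 RoundSolidTorus).incl,
          (BoundaryManifold.boundaryData 2 RoundSolidTorus).continuous_incl⟩ :
            C((BoundaryManifold.boundaryData 2 RoundSolidTorus).carrier, RoundSolidTorus)) y₀).ker).map
          (FundamentalGroup.map (⟨χ, χ.continuous⟩ : C(_, _)) y₀)
        = (FundamentalGroup.map (⟨(BoundaryManifold.boundaryData 2 RoundSolidTorus).incl,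
            (BoundaryManifold.boundaryData 2 RoundSolidTorus).continuous_incl⟩ :
              C((BoundaryManifold.boundaryData 2 RoundSolidTorus).carrier, RoundSolidTorus))
            ((⟨χ, χ.continuous⟩ : C(_, _)) y₀)).ker →
      (BoundaryManifold.boundaryData 2 RoundSolidTorus).DiffeoExtends χ)
    (h₂ : ∀ (g : ℕ) (hg : 2 ≤ g)
      (χ : (BoundaryManifold.boundaryData 2 (FlowerModel.FlowerHandlebody hg)).carrier ≃ₘ⟮𝓡 2, 𝓡 2⟯
        (BoundaryManifold.boundaryData 2 (FlowerModel.FlowerHandlebody hg)).carrier)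
      (y₀ : (BoundaryManifold.boundaryData 2 (FlowerModel.FlowerHandlebody hg)).carrier),
      ((FundamentalGroup.map (⟨(BoundaryManifold.boundaryData 2 (FlowerModel.FlowerHandlebody hg)).incl,
          (BoundaryManifold.boundaryData 2 (FlowerModel.FlowerHandlebody hg)).continuous_incl⟩ :
            C((BoundaryManifold.boundaryData 2 (FlowerModel.FlowerHandlebody hg)).carrier,
              FlowerModel.FlowerHandlebody hg)) y₀).ker).map
          (FundamentalGroup.map (⟨χ, χ.continuous⟩ : C(_, _)) y₀)
        = (FundamentalGroup.map (⟨(BoundaryManifold.boundaryData 2 (FlowerModel.FlowerHandlebody hg)).incl,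
            (BoundaryManifold.boundaryData 2 (FlowerModel.FlowerHandlebody hg)).continuous_incl⟩ :
              C((BoundaryManifold.boundaryData 2 (FlowerModel.FlowerHandlebody hg)).carrier,
                FlowerModel.FlowerHandlebody hg))
            ((⟨χ, χ.continuous⟩ : C(_, _)) y₀)).ker →
      (BoundaryManifold.boundaryData 2 (FlowerModel.FlowerHandlebody hg)).DiffeoExtends χ) :
    GriffithsExtension := by
  refine griffithsExtension_of_models fun g hg => ?_
  rcases Nat.lt_or_ge g 2 with hg2 | hg2
  · obtain rfl : g = 1 := by omega
    exact ⟨RoundSolidTorus, inferInstance, inferInstance, inferInstance, inferInstance, inferInstance,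
      isHandlebody_one_roundSolidTorus, BoundaryManifold.boundaryData 2 RoundSolidTorus, h₁⟩
  · exact ⟨FlowerModel.FlowerHandlebody hg2, inferInstance, inferInstance, inferInstance,
      inferInstance, inferInstance, FlowerModel.isHandlebody_flowerHandlebody hg2,
      BoundaryManifold.boundaryData 2 (FlowerModel.FlowerHandlebody hg2), h₂ g hg2⟩

/-! ### §4 Extendability is a diffeotopy invariant -/

section Diffeotopy

variable {n : ℕ} {M : Type u} [TopologicalSpace M] [T2Space M] [SecondCountableTopology M]
  [CompactSpace M] [ChartedSpace (EuclideanHalfSpace (n + 1)) M] [IsManifold (𝓡∂ (n + 1)) ∞ M]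

/-- **Extendability over a compact manifold with boundary is a diffeotopy invariant**: if `φ`
extends over `M` and `ψ` is diffeotopic to `φ` (`ψ ∘ φ⁻¹` diffeotopic to the identity), then `ψ`
extends — `ψ = (ψ ∘ φ⁻¹) ∘ φ` and a boundary diffeomorphism diffeotopic to the identity extends
by spreading the diffeotopy over a collar (the tree's proved
`BoundaryData.diffeoExtends_of_isDiffeotopicToId_holds`; Hirsch, *Differential Topology* (1976),
Ch. 8 §2, proof of Thm. 2.3). [cite: HirschDT1976, Ch. 8 §2, proof of Thm. 2.3] -/
theorem BoundaryData.DiffeoExtends.of_isDiffeotopic (b : BoundaryData (𝓡∂ (n + 1)) M (𝓡 n))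
    {φ ψ : b.carrier ≃ₘ⟮𝓡 n, 𝓡 n⟯ b.carrier} (hφ : b.DiffeoExtends φ)
    (h : Diffeomorph.IsDiffeotopic φ ψ) : b.DiffeoExtends ψ := by
  have h₁ : b.DiffeoExtends (φ.symm.trans ψ) :=
    BoundaryData.diffeoExtends_of_isDiffeotopicToId_holds n M b (φ.symm.trans ψ) h
  have h₂ := hφ.trans h₁
  have hψ : φ.trans (φ.symm.trans ψ) = ψ :=
    Diffeomorph.ext fun x => by
      simp only [Diffeomorph.coe_trans, Function.comp_apply, Diffeomorph.symm_apply_apply]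
  rwa [hψ] at h₂

end Diffeotopy

/-- **Griffiths' theorem from one model per positive genus, up to diffeotopy.**  It suffices that
for every `g ≥ 1` some genus-`g` handlebody `H₀` with some boundary datum `b₀` has the property:
every kernel-preserving self-diffeomorphism `χ` of `b₀.carrier` is diffeotopic to SOME
self-diffeomorphism that extends over `H₀` (§3 with §4; `H₀` is compact as a handlebody).  This
is the shape in which the classical proofs end: the meridian-disc argument (Hensel (2020),
Lemma 5.10 and Cor. 5.11: Dehn's lemma, disc surgery, the Alexander trick) and the
mapping-class-group argument both produce an extendable diffeomorphism isotopic to `χ`.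
[cite: Hensel2020HandlebodyPrimer, Cor. 5.11 and Lemma 5.10] -/
theorem griffithsExtension_of_models_isDiffeotopic
    (h : ∀ g : ℕ, 1 ≤ g → ∃ (H₀ : Type) (_ : TopologicalSpace H₀) (_ : T2Space H₀)
      (_ : SecondCountableTopology H₀) (_ : ChartedSpace (EuclideanHalfSpace 3) H₀)
      (_ : IsManifold (𝓡∂ 3) ∞ H₀) (_ : IsHandlebody g H₀) (b₀ : BoundaryData (𝓡∂ 3) H₀ (𝓡 2)),
      ∀ (χ : b₀.carrier ≃ₘ⟮𝓡 2, 𝓡 2⟯ b₀.carrier) (y₀ : b₀.carrier),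
        ((FundamentalGroup.map (⟨b₀.incl, b₀.continuous_incl⟩ : C(b₀.carrier, H₀)) y₀).ker).map
            (FundamentalGroup.map (⟨χ, χ.continuous⟩ : C(b₀.carrier, b₀.carrier)) y₀)
          = (FundamentalGroup.map (⟨b₀.incl, b₀.continuous_incl⟩ : C(b₀.carrier, H₀))
              ((⟨χ, χ.continuous⟩ : C(b₀.carrier, b₀.carrier)) y₀)).ker →
        ∃ χ₀ : b₀.carrier ≃ₘ⟮𝓡 2, 𝓡 2⟯ b₀.carrier,
          b₀.DiffeoExtends χ₀ ∧ Diffeomorph.IsDiffeotopic χ₀ χ) :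
    GriffithsExtension := by
  refine griffithsExtension_of_models fun g hg => ?_
  obtain ⟨H₀, _, _, _, _, _, hH₀, b₀, h₀⟩ := h g hg
  refine ⟨H₀, inferInstance, inferInstance, inferInstance, inferInstance, inferInstance, hH₀, b₀,
    fun χ y₀ hker => ?_⟩
  haveI := hH₀.compactSpace
  obtain ⟨χ₀, hχ₀, hiso⟩ := h₀ χ y₀ hker
  exact hχ₀.of_isDiffeotopic b₀ hiso

end Literature.Topology.FourManifolds

end

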